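import Summits.Ventures.PercRepro2.CaseOneMovesT

/-!
# The six-form calculus: the moves with the `a₂`-edge rule, and the reduction to the `a₂`-free
residual core (blind cell PercRepro2, p1 g31)

**`MoveStepT`** is `MoveStepQ` (the thickenings, the pendant step, the pocket steps, the pair step)
with two more steps: the `a₂`-EDGE step (`closedAtT_of_a2_edge_restrict`: from `G − e₂` to `G` for an
edge `e₂ = {a₂, a₃}`, the statement vertex fixed) and the FACE step (`closedAtT_of_ext`: from the
extension of `G` by a null edge to `G`); **`MovesT`** is its reflexive–transitive closure and
**`closedAtT_of_movesT`** says that the six-form closed property travels along it. The core theorem: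
**`closedAtT_of_coreTAnc`** — for ANY predicate `Anc` of six-form closed instances (`hanc`): if the
statement vertex `v` has the six forms for every weight vector on every instance of the `a₂`-FREE
RESIDUAL CORE **`InCoreTAnc … Anc`** (residual: no unmarked leaf, parallel pair, unmarked series vertex
or loop; NO edge `{a₂, v}`; not reachable by the moves of the lane from an `Anc`-instance), then it has
the six forms on EVERY finite graph (strong induction on the number of edges: a thickening step, an
`a₂`-edge deletion, or a path from an anchor); **`InCoreT`** / **`closedAtT_of_coreT`** is the
instance `Anc = ClosedAnchorT`, and hence the four forms (**`closedAt_of_coreT`**). When a new anchor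
class lands (the marked star, the uwob gadget on the T-forms) it enters through `Anc` with no new
induction. Compared with the four-form core `InCoreQ`: the `a₂`-edges at the statement
vertex are gone, the anchors are fewer (the marked star and the uwob gadget await their T-forms). Own
code; standard axioms.
-/

namespace Summit.Ventures.PercRepro2

namespace CaseOne

universe u

section MovesT
variable {V : Type*}

/-- **One move of the six-form calculus**: a move of the lane, the `a₂`-edge step, or the face step. -/
inductive MoveStepT (o a₁ a₂ b : V) :
    (E' : Type u) → [Fintype E'] → [DecidableEq E'] → (E' → Sym2 V) → V →
      (E : Type u) → [Fintype E] → [DecidableEq E] → (E → Sym2 V) → V → Prop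
  /-- a move of the lane -/
  | lane {E' : Type u} [Fintype E'] [DecidableEq E'] {ends' : E' → Sym2 V} {v' : V} {E : Type u}
      [Fintype E] [DecidableEq E] {ends : E → Sym2 V} {v : V}
      (h : MoveStepQ o a₁ a₂ b E' ends' v' E ends v) : MoveStepT o a₁ a₂ b E' ends' v' E ends v
  /-- the `a₂`-edge step: from `G − e₂` to `G`, `e₂ = {a₂, a₃}`, the statement vertex fixed -/
  | a2Edge (E : Type u) [Fintype E] [DecidableEq E] (ends : E → Sym2 V) (a₃ : V) (e₂ : E)
      (he : ends e₂ = s(a₂, a₃)) :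
      MoveStepT o a₁ a₂ b {e : E // e ≠ e₂} (restrictEnds ends e₂) a₃ E ends a₃
  /-- the face step: from the extension of `G` by a null edge to `G`, the statement vertex fixed -/
  | face (E : Type u) [Fintype E] [DecidableEq E] (ends : E → Sym2 V) (s : Sym2 V) (a₃ : V) :
      MoveStepT o a₁ a₂ b (Option E) (extEnds ends s) a₃ E ends a₃

/-- **The moves of the six-form calculus**: finitely many `MoveStepT`s. -/
inductive MovesT (o a₁ a₂ b : V) :
    (E' : Type u) → [Fintype E'] → [DecidableEq E'] → (E' → Sym2 V) → V →
      (E : Type u) → [Fintype E] → [DecidableEq E] → (E → Sym2 V) → V → Prop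
  /-- no move -/
  | refl (E : Type u) [Fintype E] [DecidableEq E] (ends : E → Sym2 V) (v : V) :
      MovesT o a₁ a₂ b E ends v E ends v
  /-- one more move -/
  | tail {E' : Type u} [Fintype E'] [DecidableEq E'] {ends' : E' → Sym2 V} {v' : V} {Em : Type u}
      [Fintype Em] [DecidableEq Em] {endsm : Em → Sym2 V} {vm : V} {E : Type u} [Fintype E]
      [DecidableEq E] {ends : E → Sym2 V} {v : V} (h : MovesT o a₁ a₂ b E' ends' v' Em endsm vm)
      (hstep : MoveStepT o a₁ a₂ b Em endsm vm E ends v) : MovesT o a₁ a₂ b E' ends' v' E ends v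

variable [Fintype V] [DecidableEq V] {R : Type*} [Field R] [LinearOrder R] [IsStrictOrderedRing R]
  {o a₁ a₂ b : V}

/-- One move of the six-form calculus preserves the six-form closed property. -/
theorem closedAtT_of_moveStepT {E' : Type u} [Fintype E'] [DecidableEq E'] {ends' : E' → Sym2 V}
    {v' : V} {E : Type u} [Fintype E] [DecidableEq E] {ends : E → Sym2 V} {v : V}
    (h : MoveStepT o a₁ a₂ b E' ends' v' E ends v) (hc : ClosedAtT (R := R) o a₁ a₂ b E' ends' v') :
    ClosedAtT (R := R) o a₁ a₂ b E ends v := by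
  cases h with
  | lane h => exact closedAtT_of_moveStepQ h hc
  | a2Edge E ends a₃ e₂ he => exact closedAtT_of_a2_edge_restrict he hc
  | face E ends s a₃ => exact closedAtT_of_ext hc

/-- **The six-form closed property is preserved by every sequence of moves of the six-form calculus.** -/
theorem closedAtT_of_movesT {E' : Type u} [Fintype E'] [DecidableEq E'] {ends' : E' → Sym2 V}
    {v' : V} {E : Type u} [Fintype E] [DecidableEq E] {ends : E → Sym2 V} {v : V}
    (h : MovesT o a₁ a₂ b E' ends' v' E ends v) (hc : ClosedAtT (R := R) o a₁ a₂ b E' ends' v') :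
    ClosedAtT (R := R) o a₁ a₂ b E ends v := by
  induction h with
  | refl => exact hc
  | tail _ hstep ih => exact closedAtT_of_moveStepT hstep ih

omit [Fintype V] [DecidableEq V] in
/-- Every sequence of moves of the lane is a sequence of moves of the six-form calculus. -/
theorem MovesT.of_movesQ {E' : Type u} [Fintype E'] [DecidableEq E'] {ends' : E' → Sym2 V} {v' : V}
    {E : Type u} [Fintype E] [DecidableEq E] {ends : E → Sym2 V} {v : V}
    (h : MovesQ o a₁ a₂ b E' ends' v' E ends v) : MovesT o a₁ a₂ b E' ends' v' E ends v := by
  induction h with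
  | refl => exact MovesT.refl _ _ _
  | tail _ hstep ih => exact MovesT.tail ih (MoveStepT.lane hstep)

/-- **Every instance reachable by moves of the six-form calculus from a six-form anchor is six-form
closed.** -/
theorem closedAtT_of_movesT_closedAnchorT {E' : Type u} [Fintype E'] [DecidableEq E']
    {ends' : E' → Sym2 V} {v' : V} (h' : ClosedAnchorT o a₁ a₂ b E' ends' v') {E : Type u} [Fintype E]
    [DecidableEq E] {ends : E → Sym2 V} {v : V} (h : MovesT o a₁ a₂ b E' ends' v' E ends v) :
    ClosedAtT (R := R) o a₁ a₂ b E ends v :=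
  closedAtT_of_movesT h (closedAtT_of_closedAnchorT o a₁ a₂ b E' ends' v' h')

end MovesT

section CoreT
variable {V : Type*} (o a₁ a₂ b v : V)

/-- **The `a₂`-free residual core relative to an anchor predicate `Anc`**: residual for `v`, no edge
`{a₂, v}`, and not reachable by the moves of the lane from an instance satisfying `Anc`. -/
def InCoreTAnc (Anc : ∀ (E₀ : Type u) [Fintype E₀] [DecidableEq E₀], (E₀ → Sym2 V) → V → Prop)
    (E : Type u) [Fintype E] [DecidableEq E] (ends : E → Sym2 V) : Prop :=
  Residual o a₁ a₂ b v E ends ∧ (∀ e, ends e ≠ s(a₂, v)) ∧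
    ¬ ∃ (E₀ : Type u) (_ : Fintype E₀) (_ : DecidableEq E₀) (ends₀ : E₀ → Sym2 V) (v₀ : V),
      Anc E₀ ends₀ v₀ ∧ MovesQ o a₁ a₂ b E₀ ends₀ v₀ E ends v

/-- **The `a₂`-free residual core of the six-form calculus**: relative to the six-form anchors
`ClosedAnchorT`. -/
def InCoreT (E : Type u) [Fintype E] [DecidableEq E] (ends : E → Sym2 V) : Prop :=
  InCoreTAnc o a₁ a₂ b v (fun E₀ _ _ ends₀ v₀ => ClosedAnchorT o a₁ a₂ b E₀ ends₀ v₀) E ends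

variable [Fintype V] [DecidableEq V] {R : Type*} [Field R] [LinearOrder R] [IsStrictOrderedRing R]

/-- **The reduction to the `a₂`-free residual core, relative to any six-form closed anchor predicate**:
the six forms for every weight vector on every core instance give them on every finite graph — strong
induction on the number of edges, one thickening step, one `a₂`-edge deletion, or one path from an
anchor at a time. -/
theorem closedAtT_of_coreTAnc
    (Anc : ∀ (E₀ : Type u) [Fintype E₀] [DecidableEq E₀], (E₀ → Sym2 V) → V → Prop)
    (hanc : ∀ (E₀ : Type u) [Fintype E₀] [DecidableEq E₀] (ends₀ : E₀ → Sym2 V) (v₀ : V),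
      Anc E₀ ends₀ v₀ → ClosedAtT (R := R) o a₁ a₂ b E₀ ends₀ v₀)
    (hcore : ∀ (E' : Type u) [Fintype E'] [DecidableEq E'] (ends' : E' → Sym2 V),
      InCoreTAnc o a₁ a₂ b v Anc E' ends' → ClosedAtT (R := R) o a₁ a₂ b E' ends' v) :
    ∀ (E : Type u) [Fintype E] [DecidableEq E] (ends : E → Sym2 V),
      ClosedAtT (R := R) o a₁ a₂ b E ends v := by
  suffices h : ∀ (n : ℕ) (E : Type u) [Fintype E] [DecidableEq E] (ends : E → Sym2 V),
      Fintype.card E = n → ClosedAtT (R := R) o a₁ a₂ b E ends v from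
    fun E _ _ ends => h _ E ends rfl
  intro n
  induction n using Nat.strong_induction_on with
  | _ n ih =>
    intro E _ _ ends hn
    by_cases hred : Reducible o a₁ a₂ b v E ends
    · -- a thickening step applies: the smaller graph is closed by induction
      obtain ⟨E₁, _, _, ends₁, hstep⟩ := hred
      exact sixForms_of_thickStep hstep (ih _ (hn ▸ hstep.card_lt) E₁ ends₁ rfl)
    by_cases ha2 : ∃ e, ends e = s(a₂, v)
    · -- an `a₂`-edge at the statement vertex: delete it
      obtain ⟨e₂, he⟩ := ha2
      have hlt : Fintype.card {e : E // e ≠ e₂} < n :=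
        hn ▸ Fintype.card_subtype_lt (x := e₂) (by simp)
      exact closedAtT_of_a2_edge_restrict he (ih _ hlt _ (restrictEnds ends e₂) rfl)
    by_cases hreach : ∃ (E₀ : Type u) (_ : Fintype E₀) (_ : DecidableEq E₀) (ends₀ : E₀ → Sym2 V)
        (v₀ : V), Anc E₀ ends₀ v₀ ∧ MovesQ o a₁ a₂ b E₀ ends₀ v₀ E ends v
    · obtain ⟨E₀, _, _, ends₀, v₀, hanc₀, hmv⟩ := hreach
      exact closedAtT_of_movesQ hmv (hanc E₀ ends₀ v₀ hanc₀)
    · push Not at ha2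
      exact hcore E ends ⟨hred, ha2, hreach⟩

/-- **The reduction to the `a₂`-free residual core**: the six forms for every weight vector on every
core instance give them on every finite graph. -/
theorem closedAtT_of_coreT
    (hcore : ∀ (E' : Type u) [Fintype E'] [DecidableEq E'] (ends' : E' → Sym2 V),
      InCoreT o a₁ a₂ b v E' ends' → ClosedAtT (R := R) o a₁ a₂ b E' ends' v) :
    ∀ (E : Type u) [Fintype E] [DecidableEq E] (ends : E → Sym2 V),
      ClosedAtT (R := R) o a₁ a₂ b E ends v :=
  closedAtT_of_coreTAnc o a₁ a₂ b v _
    (fun E₀ _ _ ends₀ v₀ h => closedAtT_of_closedAnchorT o a₁ a₂ b E₀ ends₀ v₀ h) hcore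

/-- **The four forms everywhere from the six forms on the `a₂`-free residual core.** -/
theorem closedAt_of_coreT
    (hcore : ∀ (E' : Type u) [Fintype E'] [DecidableEq E'] (ends' : E' → Sym2 V),
      InCoreT o a₁ a₂ b v E' ends' → ClosedAtT (R := R) o a₁ a₂ b E' ends' v)
    (E : Type u) [Fintype E] [DecidableEq E] (ends : E → Sym2 V) : ClosedAt R o a₁ a₂ b E ends v :=
  closedAt_of_closedAtT (closedAtT_of_coreT o a₁ a₂ b v hcore E ends)

end CoreT

end CaseOne

end Summit.Ventures.PercRepro2
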